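import Summits.BirchSwinnertonDyer.BirchSwinnertonDyer.Theorems.AlignedTransportAtTwoBSDOfMainConjectureRankOneAtTwoSigmaSqTwoVeluTransport
import Summits.BirchSwinnertonDyer.BirchSwinnertonDyer.Theorems.AlignedTransportAtTwoBSDOfMainConjectureRankOneAtTwoSigmaSqTwoIsogenyFE
import HarnessLib

/-!
# The squared `2`-isogeny functional equation for Vélu's quotient, ALL GEOMETRIC INPUTS DISCHARGED: for every model `vc • V'` of
# `V/⟨Q⟩` (`Q` a `2`-torsion point) and normalised odd formal solutions `σ` on `V`, `σ''` on `vc • V'` whose constants satisfy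
# `u²c'' − 2c − e − r = 0`:  `z²·σ''(T)² = u²·σ⁴·(X − ez²)`, i.e. `Σ''(ψP) = u²·Σ(P)²·(x(P) − x(Q))` — the per-curve residue of the
# PRINT stub `stub_sigmaSqTwo` of crux C3′ is now ONLY the constant relation + integrality (route-independent)

Cell `bsd-f1-sign2`, WIDTH-5 attach seat `bsd-line-att-p3` g8 (`--supports stmt-BirchSwinnertonDyer-23008`; plan
`Cruxes/BSDOfMainConjectureRankOneAtTwo/SIGMASQ-AT-TWO-att-p3.md`). THEOREMS ONLY. BSD is not proved by any of this.
Assembly of `X_sq_mul_sq_subst_eq_of_twoIsogeny` (IsogenyFE) with the Vélu files (Velu, VeluFormal, VeluDifferential, VeluTransport):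
the hypotheses `he`, `ht`, `hx`, `hlog`, `hπ` of the functional equation are theorems for `T = θ_vc(τ)`, `τ = zAM/Dn` the parameter of
Vélu's isogeny; at an ordinary `2` with the Frobenius-compatible model `vc = [2; r, ½, −r/2]` (recon R5/R6) this is `H''(T) = H²·V`,
`V = 4z⁴(x − e)/T²`, the input of Dwork's lemma.

## Sources
* J. Vélu, C. R. Acad. Sci. Paris 273 (1971). [cite: SilvermanAEC2009, III.4]
* B. Perrin-Riou, Mém. SMF 17 (1984), Ch. III §1.2. [cite: Perrinriou1984, Ch. III §1.2 Lemme 3 (ii)]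
* C. Blakestad, D. Grant, J. Number Theory 249 (2023), Prop. 13. [cite: BlakestadGrant2023, Prop. 13]
* J. H. Silverman, Math. Ann. 332 (2005), §5 Rem. 2. [cite: Silverman2005DivPoly, §5 Rem. 2]
-/

noncomputable section

set_option linter.dupNamespace false
set_option autoImplicit false

open scoped Classical
open PowerSeries WeierstrassCurve Literature.NumberTheory.EllipticCurves

namespace Summit.BirchSwinnertonDyer.BirchSwinnertonDyer.Theorems.AlignedTransportAtTwoSigmaSqTwo

variable {p : ℕ} [Fact p.Prime] (V : WeierstrassCurve ℚ_[p])

/-- The `2`-division condition at a `2`-torsion point `(e, f)`: `4e³ + b₂e² + 2b₄e + b₆ = 0`. [cite: SilvermanAEC2009, III.1] -/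
theorem twoTorsionPolynomial_eq_zero_of_point {R : Type*} [CommRing R] (W : WeierstrassCurve R) {e f : R}
    (hQ : f ^ 2 + W.a₁ * e * f + W.a₃ * f = e ^ 3 + W.a₂ * e ^ 2 + W.a₄ * e + W.a₆) (h2 : 2 * f + W.a₁ * e + W.a₃ = 0) :
    4 * e ^ 3 + W.b₂ * e ^ 2 + 2 * W.b₄ * e + W.b₆ = 0 := by
  simp only [WeierstrassCurve.b₂, WeierstrassCurve.b₄, WeierstrassCurve.b₆]
  linear_combination (-4) * hQ + (2 * f + W.a₁ * e + W.a₃) * h2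

/-- Vélu's `t` in `b`-form: `2t = 6e² + b₂e + b₄`. [cite: SilvermanAEC2009, III.4] -/
theorem two_mul_velu_t {R : Type*} [CommRing R] (W : WeierstrassCurve R) {e f t : R}
    (h2 : 2 * f + W.a₁ * e + W.a₃ = 0) (ht : t = 3 * e ^ 2 + 2 * W.a₂ * e + W.a₄ - W.a₁ * f) :
    2 * t = 6 * e ^ 2 + W.b₂ * e + W.b₄ := by
  simp only [WeierstrassCurve.b₂, WeierstrassCurve.b₄]
  linear_combination 2 * ht - W.a₁ * h2

/-- **The squared `2`-isogeny functional equation for Vélu's quotient, geometric inputs discharged.** `V/ℚ_p`, `Q = (e, f) ∈ V[2]`,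
`t = 3e² + 2a₂e + a₄ − a₁f`, Vélu's `V'` and ANY model `vc • V'` (`vc = (u; r, s, t₀)`), `T = θ_vc(τ)` the isogeny parameter
(`τ = zAM/Dn`); `σ` a normalised odd formal solution of `x + c = −D(Dσ/σ)` on `V`, `σ''` one on `vc • V'` with constant `c''`, and
**`−r + u²c'' − 2c − e = 0`**. Then `z²·σ''(T)² = u²·σ⁴·(X − ez²)`. [cite: Perrinriou1984, Ch. III §1.2 Lemme 3 (ii)]
[cite: BlakestadGrant2023, Prop. 13] [cite: Silverman2005DivPoly, §5 Rem. 2] -/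
theorem velu_two_X_sq_mul_sq_subst_eq {e f t : ℚ_[p]}
    (hQ : f ^ 2 + V.a₁ * e * f + V.a₃ * f = e ^ 3 + V.a₂ * e ^ 2 + V.a₄ * e + V.a₆)
    (h2 : 2 * f + V.a₁ * e + V.a₃ = 0) (ht : t = 3 * e ^ 2 + 2 * V.a₂ * e + V.a₄ - V.a₁ * f)
    {A M Dn u τ P : ℚ_[p]⟦X⟧} (hA : A = V.formalXMulSq - C e * X ^ 2) (hM : M = V.formalXMulSq * A + C t * X ^ 4)
    (hDn : Dn = V.formalXMulSq * A ^ 2 + C t * X ^ 4 * (C V.a₁ * X * A - V.formalXMulSq - C f * X ^ 3))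
    (hu : Dn * u = 1) (hτ : τ = X * A * M * u) (hP : P = A * M ^ 3 * u ^ 2)
    (V' : WeierstrassCurve ℚ_[p]) (h1' : V'.a₁ = V.a₁) (h2' : V'.a₂ = V.a₂) (h3' : V'.a₃ = V.a₃)
    (h4' : V'.a₄ = V.a₄ - 5 * t) (h6' : V'.a₆ = V.a₆ - V.b₂ * t - 7 * e * t)
    (vc : VariableChange ℚ_[p]) {T : ℚ_[p]⟦X⟧} (hT : T = (V'.formalVariableChange vc).subst τ)
    {σ σ'' : ℚ_[p]⟦X⟧} {c c'' : ℚ_[p]}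
    (hσ0 : constantCoeff σ = 0) (hσ1 : coeff 1 σ = 1) (hodd : V.IsFormallyOdd σ) (hODE : V.SatisfiesSigmaODE σ c)
    (hσ0'' : constantCoeff σ'' = 0) (hσ1'' : coeff 1 σ'' = 1) (hodd'' : (vc • V').IsFormallyOdd σ'')
    (hODE'' : (vc • V').SatisfiesSigmaODE σ'' c'')
    (hκ : -vc.r + (vc.u : ℚ_[p]) ^ 2 * c'' - 2 * c - e = 0) :
    X ^ 2 * σ''.subst T ^ 2 = C (vc.u : ℚ_[p]) ^ 2 * σ ^ 4 * (V.formalXMulSq - C e * X ^ 2) := by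
  have he := twoTorsionPolynomial_eq_zero_of_point V hQ h2
  have ht2 := two_mul_velu_t V h2 ht
  have hlog := velu_two_formalLog_transport V hQ h2 ht hA hM hDn hu hτ hP V' h1' h2' h3' h4' h6' vc hT
  have hx := velu_two_x_transport V hQ h2 ht hA hM hDn hu hτ V' h1' h2' h3' h4' h6' vc hT
  have hT0 : constantCoeff T = 0 := by
    have hτ0 : constantCoeff τ = 0 := by
      rw [hτ, map_mul, map_mul, map_mul, constantCoeff_X]; ring
    rw [hT, Literature.RingTheory.FormalGroups.constantCoeff_subst_of_constantCoeff_eq_zero hτ0,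
      constantCoeff_formalVariableChange]
  have hπ : (vc.u : ℚ_[p]) ≠ 0 := vc.u.ne_zero
  exact X_sq_mul_sq_subst_eq_of_twoIsogeny V (vc • V') hσ0 hσ1 hodd hODE hσ0'' hσ1'' hodd'' hODE'' hT0 hlog hπ he ht2 hx hκ

/-- **Sigma-squared currency**: `Σ''(T)·z² = u²·Σ²·(X − ez²)` for `Σ = σ²`, `Σ'' = σ''²` — «`Σ''(ψP) = u²Σ(P)²(x(P) − x(Q))`»; with the
Frobenius-compatible model at an ordinary `2` (`u = 2`), `H''(T) = H²·V` for `H = Σ/z²`, `V = 4z⁴(x − e)/T²`.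
[cite: Silverman2005DivPoly, §5 Rem. 2] [cite: BlakestadGrant2023, Prop. 13] -/
theorem velu_two_sq_subst_mul_X_sq_eq {e f t : ℚ_[p]}
    (hQ : f ^ 2 + V.a₁ * e * f + V.a₃ * f = e ^ 3 + V.a₂ * e ^ 2 + V.a₄ * e + V.a₆)
    (h2 : 2 * f + V.a₁ * e + V.a₃ = 0) (ht : t = 3 * e ^ 2 + 2 * V.a₂ * e + V.a₄ - V.a₁ * f)
    {A M Dn u τ P : ℚ_[p]⟦X⟧} (hA : A = V.formalXMulSq - C e * X ^ 2) (hM : M = V.formalXMulSq * A + C t * X ^ 4)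
    (hDn : Dn = V.formalXMulSq * A ^ 2 + C t * X ^ 4 * (C V.a₁ * X * A - V.formalXMulSq - C f * X ^ 3))
    (hu : Dn * u = 1) (hτ : τ = X * A * M * u) (hP : P = A * M ^ 3 * u ^ 2)
    (V' : WeierstrassCurve ℚ_[p]) (h1' : V'.a₁ = V.a₁) (h2' : V'.a₂ = V.a₂) (h3' : V'.a₃ = V.a₃)
    (h4' : V'.a₄ = V.a₄ - 5 * t) (h6' : V'.a₆ = V.a₆ - V.b₂ * t - 7 * e * t)
    (vc : VariableChange ℚ_[p]) {T : ℚ_[p]⟦X⟧} (hT : T = (V'.formalVariableChange vc).subst τ)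
    {σ σ'' : ℚ_[p]⟦X⟧} {c c'' : ℚ_[p]}
    (hσ0 : constantCoeff σ = 0) (hσ1 : coeff 1 σ = 1) (hodd : V.IsFormallyOdd σ) (hODE : V.SatisfiesSigmaODE σ c)
    (hσ0'' : constantCoeff σ'' = 0) (hσ1'' : coeff 1 σ'' = 1) (hodd'' : (vc • V').IsFormallyOdd σ'')
    (hODE'' : (vc • V').SatisfiesSigmaODE σ'' c'')
    (hκ : -vc.r + (vc.u : ℚ_[p]) ^ 2 * c'' - 2 * c - e = 0) :
    (σ'' ^ 2).subst T * X ^ 2 = C (vc.u : ℚ_[p]) ^ 2 * (σ ^ 2) ^ 2 * (V.formalXMulSq - C e * X ^ 2) := by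
  have h := velu_two_X_sq_mul_sq_subst_eq V hQ h2 ht hA hM hDn hu hτ hP V' h1' h2' h3' h4' h6' vc hT hσ0 hσ1 hodd hODE
    hσ0'' hσ1'' hodd'' hODE'' hκ
  have hT0 : constantCoeff T = 0 := by
    have hτ0 : constantCoeff τ = 0 := by
      rw [hτ, map_mul, map_mul, map_mul, constantCoeff_X]; ring
    rw [hT, Literature.RingTheory.FormalGroups.constantCoeff_subst_of_constantCoeff_eq_zero hτ0,
      constantCoeff_formalVariableChange]
  rw [subst_pow (HasSubst.of_constantCoeff_zero' hT0)]
  linear_combination h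

end Summit.BirchSwinnertonDyer.BirchSwinnertonDyer.Theorems.AlignedTransportAtTwoSigmaSqTwo
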